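import Literature.AnabelianGeometry.SemiGraphs.PreimageComponentRestrictRange
import Literature.AnabelianGeometry.SemiGraphs.DecompositionGroupRestrict
import Literature.AnabelianGeometry.SemiGraphs.SubgraphComponentsDoubleCosetsOfStabilizers
import Literature.AnabelianGeometry.SemiGraphs.Corollary27iAtCoveringHomCan
import Literature.AnabelianGeometry.SemiGraphs.CommensurabilityProp25iProofs

/-!
# [SemiAnbd] Cor. 2.7 (i), Rmk. 2.7.2, Cor. 2.7 (ii) HOLD — via decomposition groups of restricted coverings

Mochizuki, *Semi-graphs of anabelioids*, Publ. RIMS **42** (2006) 221–322, §2, Corollary 2.7 (i)/(ii)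
p. 30 and Remark 2.7.2 p. 30 [cite: MochizukiSemiAnbd2006, Cor. 2.7(i) p.30]: for a connected,
quasi-coherent graph of anabelioids, the subgroups `Π_ℍ ≤ Π_𝒢` of connected sub-semi-graphs with elevated
vertices (in particular the verticial subgroups of elevated vertices) are commensurably terminal.

abc-iut cell, layer L3, D3b four-way cut (abc-iut-L3-lead α7-1) — the (CORE)+(COMP)+(T) route assembled
(abc-iut-w4-d071; HOT-SPARE of the (RS)+closer landing of record by abc-iut-L3-d3 / abc-iut-w5-d041).
PROOF-ONLY file (no `def`, no new named fact).  Chain, every link a kernel theorem: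

1. abc-iut-L6-t17's (COMP) `Hom.IsPreimageComponent.range_ι_restrict_eq_preimage`
   (`PreimageComponentRestrictRange.lean`): for a preimage component `K` of a sub-GRAPH `ℍ` (clopen in
   `K̄ := φ⁻¹ℍ`), `range ι_{ψ_K} = range ι_{ψ̄}` (`ψ_K := φ|_K`, `ψ̄ := φ|_{K̄}`);
2. `matchedStabilizers_coveringHomCan_galois` — (ST) «matched stabilizers» at the covering of record
   `φ := A.coveringHomCan`, for GALOIS `A`, with NO (RS) hypothesis: at every vertex `w″` of every
   component `K`, the point `x₀` of (D1′) (`covering_decompositionGroup_of_isGlobalCoveringOf`,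
   abc-iut-w4-d071) has `range ι = Stab_{Π_𝒢}(x₀)` and `range ι_{ψ_K} = comap (Π_ℍ → Π_𝒢) (range ι)`
   (`range_ι_restrict_preimage_eq_comap` (CORE, abc-iut-w4-d071) ∘ (COMP)) `= Stab_{Π_ℍ}(x₀)`;
3. `subgraphComponents_doubleCosets_coveringHomCan_galois` — (D3) at `coveringHomCan` for Galois `A`
   (= abc-iut-w4-d071's hypothesis `hD3cov`, verbatim) by abc-iut-w5-d041's
   `covering_subgraphComponents_doubleCosets_body_of_stabilizers`;
4. `corollary_2_7_i_holds`, `remark_2_7_2_holds`, `corollary_2_7_ii_holds` (the latter with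
   abc-iut-w4-d063's `proposition_2_5_i_holds`) by abc-iut-w4-d071's `…_coveringHomCan` closers.

So the named facts `corollary_2_7_i` (F-1458), `remark_2_7_2` (F-1465), `corollary_2_7_ii` (F-1459) are
kernel theorems.  CREDIT (abc-iut-L3-lead α24-2): the dictionary (D0)–(D9) and the Cor. 2.7 (i) engine are
abc-iut-L3-d3's (`FiniteEtaleCoveringDictionary.lean`, `CommensurableTerminalityProofs.lean`); the constructed
covering `𝒢_A → 𝒢` with its local/global clauses is abc-iut-L3-t5's (`CoveringOfObject*.lean`, `CoveringGlobalProofs.lean`;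
canonical 2-cells abc-iut-w4-d096, branch alignment abc-iut-L4-t17, vertex alignment abc-iut-w4-d071); the bridge (T)
and the component passage (COMP) are abc-iut-L6-t17's; the reduction of (D3) to matched stabilizers and the counting
clauses (P1)(P2) are abc-iut-w5-d041's; (D1) is abc-iut-L6-d4's, its connectedness-free form (D1′), the relabelling
(CORE) and the closers are abc-iut-w4-d071's; Prop. 2.6 is abc-iut-L3-d1/abc-iut-L6-t18's, Prop. 2.5 (i) abc-iut-w4-d063's.
A second, independent proof via abc-iut-L3-d3's restriction equivalence (RS) lands separately.  Honest framing:
[SemiAnbd] is a published, refereed prerequisite; nothing here bears on [IUTchIII] Cor. 3.12.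
-/

namespace Literature.AnabelianGeometry.SemiGraphs

open CategoryTheory CategoryTheory.Limits CategoryTheory.Functor CategoryTheory.PreGaloisCategory
open Literature.AnabelianGeometry.Anabelioids
open scoped Pointwise

universe v₁ u₁ u

namespace SemiGraphOfAnabelioids

variable {𝒢 : SemiGraphOfAnabelioids.{v₁, u₁, u}}

/-- **(ST) «matched stabilizers» at the covering of record, for GALOIS `A` — unconditionally.**  At every
vertex `w″` of every preimage component `K` of a connected sub-graph `ℍ`, for all constituent basepoints
`(F″, F₂, e₂)`, ONE point `a` of the fibre of `A` has `range ι_{ψ_K} = Stab_{Π_ℍ}(a)` (`ψ_K := φ|_K`) and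
`range ι = Stab_{Π_𝒢}(a)`: take `a := x₀` of (D1′) at `w″`; the first identity is (COMP) ∘ (CORE) read
through `Stab_{Π_ℍ} = comap (Π_ℍ → Π_𝒢) Stab_{Π_𝒢}`.  Same conclusion as abc-iut-w5-d041's
`matchedStabilizers_coveringHomCan_of_restrictGlobal_galois`, WITHOUT its (RS) hypothesis.
[cite: MochizukiSemiAnbd2006, Cor. 2.7(i) p.30] -/
theorem matchedStabilizers_coveringHomCan_galois :
    ∀ (𝒢 : SemiGraphOfAnabelioids.{v₁, u₁, u}) (A : 𝒢.BObj) (hc : 𝒢.IsConnected),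
      @IsGalois 𝒢.BObj _ (𝒢.galoisCategory_bObj hc) A → A.coveringGraph.IsConnected →
      ∀ (H : 𝒢.graph.Subgraph), H.toSemiGraph.IsConnected → H.toSemiGraph.IsGraph →
      ∀ (K : {K : A.coveringGraph.graph.Subgraph // A.coveringHomCan.IsPreimageComponent H K})
        (w'' : K.1.toSemiGraph.Vertex) (F'' : A.coveringGraph.V w''.1 ⥤ FintypeCat.{v₁})
        [FiberFunctor F'']
        (F₂ : 𝒢.V (A.coveringHomCan.base.vertexMap w''.1) ⥤ FintypeCat.{v₁}) [FiberFunctor F₂]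
        (e₂ : (A.coveringHomCan.φV w''.1).pullback ⋙ F'' ≅ F₂),
        ∃ a : (𝒢.ρ (A.coveringHomCan.base.vertexMap w''.1) ⋙ F₂).obj A,
          ((Aut.autMulEquivOfIso
                (isoWhiskerLeft
                  ((𝒢.restrict H).ρ ⟨A.coveringHomCan.base.vertexMap w''.1, K.2.2.2.2.1 w''.2⟩)
                  e₂)).toMonoidHom.comp
              (pi1Map (A.coveringHomCan.restrict K.1 H K.2.2.2.2.1 K.2.2.2.2.2.1).pullbackFunctor
                ((A.coveringGraph.restrict K.1).ρ w'' ⋙ F''))).range =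
            MulAction.stabilizer
              (𝒢.PiH H ⟨A.coveringHomCan.base.vertexMap w''.1, K.2.2.2.2.1 w''.2⟩ F₂)
              (show ((𝒢.restrict H).ρ ⟨A.coveringHomCan.base.vertexMap w''.1, K.2.2.2.2.1 w''.2⟩ ⋙
                F₂).obj ((𝒢.restrictFunctor H).obj A) from a) ∧
          ((Aut.autMulEquivOfIso (isoWhiskerLeft (𝒢.ρ (A.coveringHomCan.base.vertexMap w''.1)) e₂)
              ).toMonoidHom.comp
              (pi1Map A.coveringHomCan.pullbackFunctor (A.coveringGraph.ρ w''.1 ⋙ F''))).range =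
            MulAction.stabilizer (𝒢.Pi (A.coveringHomCan.base.vertexMap w''.1) F₂) a := by
  intro 𝒢 A hc hA _ H _ hHg K w'' F'' _ F₂ _ e₂
  -- (D1′) at `w″`: `range ι = Stab(x₀)`
  obtain ⟨x₀, -, hx₀⟩ := covering_decompositionGroup_of_isGlobalCoveringOf A.coveringHomCan A
    A.coveringHomCan_isGlobalCoveringOf w''.1 F'' F₂ e₂
  -- (COMP) (abc-iut-L6-t17): `range ι_{ψ_K} = range ι_{ψ̄}`
  have hcomp := Hom.IsPreimageComponent.range_ι_restrict_eq_preimage K.2 A.fibreData.isProper_proj hHg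
    w'' F'' F₂ e₂
  -- (CORE): `range ι_{ψ̄} = comap (Π_ℍ → Π_𝒢) (range ι)`
  have hcore := range_ι_restrict_preimage_eq_comap hc A hA H ⟨w''.1, K.2.2.2.2.1 w''.2⟩ F'' F₂ e₂
  refine ⟨x₀, ?_, hx₀⟩
  refine (hcomp.trans hcore).trans ?_
  rw [hx₀]
  exact (stabilizer_restrict_eq_comap_piHToPi H ⟨A.coveringHomCan.base.vertexMap w''.1,
    K.2.2.2.2.1 w''.2⟩ F₂ A x₀).symm

/-- **(D3) at the covering of record `𝒢_A → 𝒢`, for Galois objects `A`** — abc-iut-w4-d071's hypothesis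
`hD3cov` (binders of the dictionary item (D3) verbatim, `𝒢′ := A.coveringGraph`, `φ := A.coveringHomCan`,
plus `IsGalois A`), now a THEOREM: abc-iut-w5-d041's `covering_subgraphComponents_doubleCosets_body_of_stabilizers`
fed with `matchedStabilizers_coveringHomCan_galois`. [cite: MochizukiSemiAnbd2006, Cor. 2.7(i) p.30] -/
theorem subgraphComponents_doubleCosets_coveringHomCan_galois :
    ∀ (𝒢 : SemiGraphOfAnabelioids.{v₁, u₁, u}) (A : 𝒢.BObj) (hc : 𝒢.IsConnected),
      @IsGalois 𝒢.BObj _ (𝒢.galoisCategory_bObj hc) A →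
      A.coveringGraph.IsConnected → A.coveringHomCan.IsFiniteEtaleCoveringOf A →
      A.coveringHomCan.IsGlobalCoveringOf A → A.coveringHomCan.IsVertexAligned →
      ∀ (v' : A.coveringGraph.graph.Vertex) (F' : A.coveringGraph.V v' ⥤ FintypeCat.{v₁})
        [FiberFunctor F'] (F : 𝒢.V (A.coveringHomCan.base.vertexMap v') ⥤ FintypeCat.{v₁})
        [FiberFunctor F] (e : (A.coveringHomCan.φV v').pullback ⋙ F' ≅ F)
        (H : 𝒢.graph.Subgraph), H.toSemiGraph.IsConnected → H.toSemiGraph.IsGraph →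
        ∀ (hv : A.coveringHomCan.base.vertexMap v' ∈ H.verts),
        let v := A.coveringHomCan.base.vertexMap v'
        let ι : A.coveringGraph.Pi v' F' →* 𝒢.Pi v F :=
          (Aut.autMulEquivOfIso (Functor.isoWhiskerLeft (𝒢.ρ v) e)).toMonoidHom.comp
            (pi1Map A.coveringHomCan.pullbackFunctor (A.coveringGraph.ρ v' ⋙ F'))
        let PH : Subgroup (𝒢.Pi v F) := (𝒢.piHToPi H ⟨v, hv⟩ F).range
        ∀ x₀ : (𝒢.ρ v ⋙ F).obj A, ι.range = MulAction.stabilizer (𝒢.Pi v F) x₀ →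
          ∃ d : {K : A.coveringGraph.graph.Subgraph // A.coveringHomCan.IsPreimageComponent H K} →
              𝒢.Pi v F,
            Function.Bijective (fun K => DoubleCoset.mk PH ι.range (d K)) ∧
            (∃ K₀ : {K : A.coveringGraph.graph.Subgraph // A.coveringHomCan.IsPreimageComponent H K},
              v' ∈ K₀.1.verts) ∧
            (∀ (K : {K : A.coveringGraph.graph.Subgraph // A.coveringHomCan.IsPreimageComponent H K})
              (hK : v' ∈ K.1.verts),
              d K ∈ ι.range ∧
                (ι.comp (A.coveringGraph.piHToPi K.1 ⟨v', hK⟩ F')).range = ι.range ⊓ PH) ∧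
            ∀ (K : {K : A.coveringGraph.graph.Subgraph // A.coveringHomCan.IsPreimageComponent H K})
              (w'' : K.1.toSemiGraph.Vertex) (F'' : A.coveringGraph.V w''.1 ⥤ FintypeCat.{v₁})
              [FiberFunctor F''] (α : A.coveringGraph.ρ w''.1 ⋙ F'' ≅ A.coveringGraph.ρ v' ⋙ F'),
              ∃ g : 𝒢.Pi v F,
                (ι.comp ((Aut.autMulEquivOfIso α).toMonoidHom.comp
                  (A.coveringGraph.piHToPi K.1 w'' F''))).range =
                    ι.range ⊓ ConjAct.toConjAct g⁻¹ • PH := by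
  intro 𝒢 A hc hA h𝒢' hloc hB _ v' F' _ F _ e H hH hHg hv
  dsimp only
  intro x₀ hx₀
  exact covering_subgraphComponents_doubleCosets_body_of_stabilizers hc h𝒢' A.coveringHomCan A hloc hB
    v' F' F e H hH hHg hv
    (fun K w'' F'' _ F₂ _ e₂ => matchedStabilizers_coveringHomCan_galois 𝒢 A hc hA h𝒢' H hH hHg K w''
      F'' F₂ e₂) x₀ hx₀

/-- **[SemiAnbd] Cor. 2.7 (i) HOLDS** (the named fact `corollary_2_7_i`, F-1458): for a connected,
quasi-coherent graph of anabelioids `𝒢`, `Π_ℍ ≤ Π_𝒢` is commensurably terminal for every connected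
sub-graph `ℍ` with elevated vertices, and `Π_v ≤ Π_𝒢` for every elevated vertex `v`.
[cite: MochizukiSemiAnbd2006, Cor. 2.7(i) p.30] -/
theorem corollary_2_7_i_holds : (corollary_2_7_i.{v₁, u₁, u} : Prop) :=
  corollary_2_7_i_of_subgraphComponents_doubleCosets_coveringHomCan
    subgraphComponents_doubleCosets_coveringHomCan_galois

/-- **[SemiAnbd] Rmk. 2.7.2 HOLDS** (the named fact `remark_2_7_2`, F-1465): the subgroups `J` with
`Π_v ≥ J` open in an elevated verticial subgroup are commensurably terminal.
[cite: MochizukiSemiAnbd2006, Rem. 2.7.2 p.30] -/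
theorem remark_2_7_2_holds : (remark_2_7_2.{v₁, u₁, u} : Prop) :=
  remark_2_7_2_of_subgraphComponents_doubleCosets_coveringHomCan
    subgraphComponents_doubleCosets_coveringHomCan_galois

/-- **[SemiAnbd] Cor. 2.7 (ii) HOLDS** (the named fact `corollary_2_7_ii`, F-1459), with Prop. 2.5 (i)
supplied by abc-iut-w4-d063's `proposition_2_5_i_holds`. [cite: MochizukiSemiAnbd2006, Cor. 2.7(ii) p.30] -/
theorem corollary_2_7_ii_holds : (corollary_2_7_ii.{v₁, u₁, u} : Prop) :=
  corollary_2_7_ii_of_prop25i_subgraphComponents_doubleCosets_coveringHomCan proposition_2_5_i_holds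
    subgraphComponents_doubleCosets_coveringHomCan_galois

end SemiGraphOfAnabelioids

end Literature.AnabelianGeometry.SemiGraphs
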